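/-
Copyright (c) 2026 the pub-hodgecm-mathlib formalisation cell (harness21).  Prover seat hodgecm-mathlib-F0P3a-p03 (g25): N8-INNER road, brick (10)(C′)
«CORNER EP PACKAGE», FILE F-D (the head: the scalar-corner one-place EP generator, over the central generator of brick (10)(B)).
-/
import Literature.NumberTheory.Rogawski1990.ArchCornerOnePlaceGlue        -- ★ F-C (this seat): glue, alternation, slot sum
import Literature.NumberTheory.Rogawski1990.ArchCornerOnePlaceValue       -- ★ F-C′ (this seat): the value `12 h₁(0) = 6ℓ`
import Literature.NumberTheory.Rogawski1990.ArchCornerClassTube           -- ★ T p852137 (this seat): `exists_cornerClassTubeG_compact ∕ _split`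
import Literature.NumberTheory.Rogawski1990.ArchEPGeneratorHead           -- ★ E1: `EPGeneratorAt`, `epGeneratorAt_iff`
import Literature.Analysis.Calculus.CornerClassEmbedding                  -- ★ (E) p852090: `exists_contDiffOn_comp_cornerClass_of_forall_perm`
import Literature.NumberTheory.Rogawski1990.ArchRankTwoCentralGenerator   -- ★ (10)(B) p852226 (F0P3a-p08): `exists_centralType_generator` (the corner central generator, unconditional)
import Literature.NumberTheory.Rogawski1990.ArchTransfFamilySymmetries      -- ★ `gprimeTorus_angleShift_eq_one` (2π-periodicity of the charts in the angle slots)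
import HarnessLib

/-!
# The scalar-corner one-place Euler–Poincaré generator `EPGeneratorAt L β₀ w ν_w (esymm3 (ζ,ζ,ζ))` over the central generator (N8-INNER brick (10)(C′), FILE F-D)

Topic `NumberTheory/Rogawski1990`; namespace `Literature.NumberTheory.Rogawski1990`.  THEOREMS ONLY (no `def`, no instance, no notation, no axiom, no named
fact, no `sorry`); kernel lane `--supports stmt-HodgeConjecture-24833`.  Cell `pub/hodgecm-mathlib`, crux H413; road N8-INNER (owner LH2-plan (g1)), brick (10)(C′)
«CORNER EP PACKAGE» (F0P3a-p03 (g25); sigsheet `F0/P3a/F0P3a-p03/g25/cprime/SIGSHEET-N8-brick10Cprime-assembly.v1` + k12 re-cut, ref5 R-749∕R-756 «=»).  Count-neutral.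

THE HEAD `epGeneratorAt_scalar_corner_of_centralGenerator`.  `β₀ = (½, 1, −½)`, `w` a complex place (one-place measures `ν′_v`, product convention `hν` of ★ G3 — the block of
★ (J)), `ζ ∈ S¹`.  BINDERS = the four tokens of brick (10)(B)'s central generator (F0P3a-p08, FILE B `exists_centralType_generator`): an ambient `fa ∈ C^∞(M₃(ℂ))` with
`fa ∘ (↑↑·)` compactly supported on `U(β₀)_w`, `fa(ζ•1) ≠ 0`, and the SPLIT one-place readings `chartOrbGLoc L β₀ w S′ ν′_w (fa∘↑↑) cw` (`w ∈ S′`, `cw₀ ≠ 0`) VANISHING whenever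
the boost eigenvalues of `cw` are `ε_B`-close to `ζ`.  CONCLUSION: ★ E1's `EPGeneratorAt L β₀ w (ν′_w w) (esymm3 (ζ,ζ,ζ))`.
PROOF.  Split clause: the class tube ★ `exists_cornerClassTubeG_split` puts the boost eigenvalues `ε_B`-close to `ζ`, and (B) vanishes.  Compact clause: reduce the label to `∅`
(★ `chartOrbGLoc_eq_of_mem_iff`) and the angles to the fundamental representative `θ_ζ•1 + x`, `x` small and regular (★ `exists_cornerClassTubeG_compact`, ★ `mul_exp_arg_div_eq`,
★ `continuousAt_arg_div_const`, periodicity ★ `sum_perm_chartOrbGLoc_congr_of_circleExp_eq`); there the slot sum is `h₁(x)∕u(x)` (★ F-C: glue `F̃` from ★ (J)'s zero jumps under (B),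
alternation `Vand•h₁`, ★ F-B `N = u·π`), a symmetric smooth germ, hence (two cut-offs: ★ `exists_contDiff_prod_cutoff` then ★ `exists_contDiff_eq_one_closedBall_tsupport_subset`) a
globally smooth function `h` of the class (★ (E) `exists_contDiffOn_comp_cornerClass_of_forall_perm`); and `h(b) = h₁(0)∕u(0) ≠ 0` by ★ F-C′ (`12h₁(0) = −6c′i·fa(ζ•1)`, `c′ > 0`).
HONEST LABEL: HC_CM is proved only modulo the 7 printed citations (2 remaining: hLiu418 = `stmt-HodgeConjecture-24832`, h413 = `stmt-HodgeConjecture-24833`) until rung 0 closes;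
this file is one input (the corner case of `hEP`) of the EP assembly E3 and pays nothing by itself; its binders are discharged by brick (10)(B).

## References
* [Rogawski1990] J. D. Rogawski, *Automorphic Representations of Unitary Groups in Three Variables*, Ann. of Math. Stud. 123 (1990), §8.2 p. 122, §8.4 pp. 126–127, §14.2 p. 232.
* [Shelstad1979] D. Shelstad, *Characters and inner forms of a quasi-split group over ℝ*, Compositio Math. 39 (1979), §4 pp. 22–26.
* [Bouaziz1994IntegralesOrbitales] A. Bouaziz, *Intégrales orbitales sur les algèbres de Lie réductives*, Invent. Math. 115 (1994), §3.2, §6.2.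
* [HarishChandra1975HARRG1] Harish-Chandra, *Harmonic analysis on real reductive groups I*, J. Funct. Anal. 19 (1975), §17 Lemma 17.5.
-/

set_option autoImplicit false

noncomputable section

open MeasureTheory MeasureTheory.Measure NumberField NumberField.InfinitePlace Matrix Complex Set Filter Topology Function Metric
open scoped MatrixGroups Matrix Real Classical ENNReal NNReal ContDiff
open Literature.NumberTheory.Automorphic Literature.NumberTheory.Automorphic.UnitaryGroup Literature.NumberTheory.Automorphic.ArchCartan
open Literature.NumberTheory.Automorphic.Shelstad1979.StableOrbitalIntegrals
open Literature.Geometry.ComplexHyperbolic.BallModel Literature.Analysis.Calculus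

namespace Literature.NumberTheory.Rogawski1990

section Corner

variable (L : Type) [Field L] [NumberField L] [IsCMField L]
  [∀ v : {w : InfinitePlace L // IsComplex w}, MeasurableSpace ↥(archLocal L 3 (Matrix.diagonal ![(2 : L)⁻¹, 1, -(2 : L)⁻¹]) v)]
  [∀ v : {w : InfinitePlace L // IsComplex w}, BorelSpace ↥(archLocal L 3 (Matrix.diagonal ![(2 : L)⁻¹, 1, -(2 : L)⁻¹]) v)]
  [MeasurableSpace ↥(arch (↥(maximalRealSubfield L)) L (IsCMField.complexConj L) 3 (Matrix.diagonal ![(2 : L)⁻¹, 1, -(2 : L)⁻¹]))]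
  [BorelSpace ↥(arch (↥(maximalRealSubfield L)) L (IsCMField.complexConj L) 3 (Matrix.diagonal ![(2 : L)⁻¹, 1, -(2 : L)⁻¹]))]
  (ν'w : ∀ v : {w : InfinitePlace L // IsComplex w}, Measure ↥(archLocal L 3 (Matrix.diagonal ![(2 : L)⁻¹, 1, -(2 : L)⁻¹]) v))
  [∀ v, (ν'w v).IsHaarMeasure] [∀ v, (ν'w v).IsMulRightInvariant]
  (ν' : Measure ↥(arch (↥(maximalRealSubfield L)) L (IsCMField.complexConj L) 3 (Matrix.diagonal ![(2 : L)⁻¹, 1, -(2 : L)⁻¹]))) [ν'.IsHaarMeasure] [ν'.IsMulRightInvariant]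
  (hν : ν' = (Measure.pi ν'w).map (archPiEquivCM 3 L (Matrix.diagonal ![(2 : L)⁻¹, 1, -(2 : L)⁻¹])).symm)
  (w : {w : InfinitePlace L // IsComplex w})

open scoped Matrix.Norms.Operator

/-- The angle representative of a phase: with `x_k := arg(e^{i cw_k} ∕ ζ)`, `e^{i(θ_ζ + x_k)} = e^{i cw_k}`. [cite: Rogawski1990, §8.4 p. 126] -/
theorem circleExp_const_add_arg_eq {ζ : Circle} {θζ : ℝ} (hζ : Circle.exp θζ = ζ) (cw : Fin 3 → ℝ) (k : Fin 3) :
    Circle.exp (((fun _ : Fin 3 => θζ) + fun k => Complex.arg (((Circle.exp (cw k) : Circle) : ℂ) / (ζ : ℂ))) k) = Circle.exp (cw k) := by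
  rw [circleExp_const_add, hζ]
  exact mul_exp_arg_div_eq ζ (Circle.exp (cw k))

/-- Near the centre the angle representative is small: for every `η′ > 0` there is `η > 0` with `|arg(z_k∕ζ)| < η′` for all `k` as soon as `‖z_k − ζ‖ < η` for all `k`.
[cite: Rogawski1990, §8.4 p. 126] -/
theorem exists_forall_arg_div_small (ζ : Circle) {η' : ℝ} (hη' : 0 < η') :
    ∃ η : ℝ, 0 < η ∧ ∀ z : Fin 3 → Circle, (∀ k, ‖((z k : Circle) : ℂ) - (ζ : ℂ)‖ < η) →
      (fun k : Fin 3 => Complex.arg (((z k : Circle) : ℂ) / (ζ : ℂ))) ∈ ball (0 : Fin 3 → ℝ) η' := by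
  have hc := continuousAt_arg_div_const ζ
  have h0 : (fun k : Fin 3 => Complex.arg ((((fun _ : Fin 3 => ζ) k : Circle) : ℂ) / (ζ : ℂ))) = 0 := by
    funext k; simp
  obtain ⟨η, hη, hball⟩ := Metric.continuousAt_iff.1 hc η' hη'
  refine ⟨η, hη, fun z hz => ?_⟩
  have hd : dist z (fun _ : Fin 3 => ζ) < η := (dist_pi_lt_iff hη).2 fun k => by
    change dist ((z k : Circle) : ℂ) ((ζ : Circle) : ℂ) < η
    rw [dist_eq_norm]; exact hz k
  have := hball hd
  rwa [h0, dist_eq_norm, sub_zero, ← mem_ball_zero_iff] at this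

include hν in
/-- **THE SCALAR-CORNER ONE-PLACE EP GENERATOR OVER THE CENTRAL GENERATOR.**  At the quasi-split frame `β₀ = (½,1,−½)`, a complex place `w` and a centre `ζ ∈ S¹`: given an ambient
`fa ∈ C^∞(M₃(ℂ))`, compactly supported on `U(β₀)_w`, with `fa(ζ•1) ≠ 0`, whose SPLIT one-place readings vanish at every Cayley coordinate `cw` (`cw₀ ≠ 0`) with boost
eigenvalues `ε_B`-close to `ζ` (the central generator of brick (10)(B)), the one-place EP head ★ `EPGeneratorAt L β₀ w (ν′_w w) (esymm3 (ζ,ζ,ζ))` holds with the test function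
`fa ∘ (↑↑·)`: split readings vanish near the corner class (★ class tube), and on compact charts the stable slot sum is a smooth class function `h` with `h(esymm3(ζ,ζ,ζ)) ≠ 0`
(★ F-B, ★ F-C, ★ F-C′, ★ (E), ★ (J), and the letter ★ `ArchCentralLimitFormulaRankTwo_holds`).
[cite: Rogawski1990, §8.2 p. 122; §8.4 pp. 126–127; §14.2 (14.2.1) p. 232] [cite: Shelstad1979, §4 Lemma 4.2 p. 23, Lemma 4.3 p. 25] [cite: Bouaziz1994IntegralesOrbitales, §6.2 p. 591]
[cite: HarishChandra1975HARRG1, §17 Lemma 17.5] -/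
theorem epGeneratorAt_scalar_corner_of_centralGenerator (ζ : Circle) (fa : Matrix (Fin 3) (Fin 3) ℂ → ℂ) (hfa : ContDiff ℝ ∞ fa)
    (hsupp : HasCompactSupport fun g : ↥(archLocal L 3 (Matrix.diagonal ![(2 : L)⁻¹, 1, -(2 : L)⁻¹]) w) => fa ((g : GL (Fin 3) ℂ) : Matrix (Fin 3) (Fin 3) ℂ))
    (hval : fa ((ζ : ℂ) • (1 : Matrix (Fin 3) (Fin 3) ℂ)) ≠ 0)
    (hvan : ∃ εB : ℝ, 0 < εB ∧ ∀ (S' : Finset {w : InfinitePlace L // IsComplex w}), w ∈ S' → ∀ cw : Fin 3 → ℝ, cw 0 ≠ 0 →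
      (∀ i, ‖boostEig cw i - (ζ : ℂ)‖ < εB) →
        chartOrbGLoc L ![(2 : L)⁻¹, 1, -(2 : L)⁻¹] w S' (ν'w w) (fun g => fa ((g : GL (Fin 3) ℂ) : Matrix (Fin 3) (Fin 3) ℂ)) cw = 0) :
    EPGeneratorAt L ![(2 : L)⁻¹, 1, -(2 : L)⁻¹] w (ν'w w) (esymm3 fun _ : Fin 3 => (ζ : ℂ)) := by
  -- ## data
  set f : ↥(archLocal L 3 (Matrix.diagonal ![(2 : L)⁻¹, 1, -(2 : L)⁻¹]) w) → ℂ := fun g => fa ((g : GL (Fin 3) ℂ) : Matrix (Fin 3) (Fin 3) ℂ) with hfdef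
  have hf : ∀ g, f g = fa ((g : GL (Fin 3) ℂ) : Matrix (Fin 3) (Fin 3) ℂ) := fun _ => rfl
  have hfs : HasCompactSupport f := hsupp
  set θζ : ℝ := Complex.arg (ζ : ℂ) with hθζ
  have hζ : Circle.exp θζ = ζ := Circle.exp_arg ζ
  have hζn : ‖(ζ : ℂ)‖ = 1 := Circle.norm_coe ζ
  set b : ℂ × ℂ × ℂ := esymm3 fun _ : Fin 3 => (ζ : ℂ) with hbdef
  have hw0 : w ∉ (∅ : Finset {w : InfinitePlace L // IsComplex w}) := Finset.notMem_empty w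
  obtain ⟨εB, hεB, hvanB⟩ := hvan
  -- ## §1 glue, alternation, unit, value (★ F-B, F-C, F-C′)
  obtain ⟨r, hr, hr4, Ft, hFt, hFtR⟩ := exists_smooth_glue_normalisedReading L ν'w ν' hν w ζ hζ f fa hfa hf hfs hεB
    (fun cw h0 hB => hvanB {w} (Finset.mem_singleton_self w) cw h0 hB)
  obtain ⟨H, h₁, hH, hh₁, hh₁σ, hHFt, hA⟩ := exists_cutoff_and_alternation_eq_vandermonde_smul hr hFt
  obtain ⟨u, hu, hu0, hN, huσ⟩ := exists_smooth_symmetric_unit_normaliser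
  obtain ⟨c, hc, h12⟩ := exists_letterConstant_twelve_mul_eq L w (ν'w w) ζ hζ f fa hfa hf hfs hr Ft H h₁ hFtR hH hh₁ hHFt hA
  have hdiag : ((circleDiagonal 3 (fun _ : Fin 3 => ζ) : GL (Fin 3) ℂ) : Matrix (Fin 3) (Fin 3) ℂ) = (ζ : ℂ) • (1 : Matrix (Fin 3) (Fin 3) ℂ) := by
    rw [coe_circleDiagonal, Matrix.smul_one_eq_diagonal]
  have hh₁0 : h₁ 0 ≠ 0 := by
    intro h0
    rw [h0, mul_zero, hdiag] at h12
    have : (6 : ℂ) * (-((c : ℂ) * Complex.I) * fa ((ζ : ℂ) • (1 : Matrix (Fin 3) (Fin 3) ℂ))) ≠ 0 :=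
      mul_ne_zero (by norm_num) (mul_ne_zero (neg_ne_zero.2 (mul_ne_zero (Complex.ofReal_ne_zero.2 hc.ne') Complex.I_ne_zero)) hval)
    exact this h12.symm
  -- ## §2 the symmetric germ `h₁ ∕ u` near `0`, cut off symmetrically, as a smooth function of the class (★ (E))
  obtain ⟨r₁, hr₁, hune⟩ : ∃ r₁ : ℝ, 0 < r₁ ∧ ∀ x ∈ ball (0 : Fin 3 → ℝ) r₁, u x ≠ 0 := by
    have ho : IsOpen {x : Fin 3 → ℝ | u x ≠ 0} := isOpen_ne_fun hu.continuous continuous_const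
    obtain ⟨r₁, hr₁, hsub⟩ := Metric.isOpen_iff.1 ho 0 hu0
    exact ⟨r₁, hr₁, fun x hx => hsub hx⟩
  set r₂ : ℝ := min (r / 4) r₁ with hr₂def
  have hr₂ : 0 < r₂ := lt_min (by positivity) hr₁
  obtain ⟨χ, hχ, hχ1, hχsupp, hχσ⟩ := exists_contDiff_prod_cutoff 3 (0 : ℝ) (r' := r₂ / 2) (r := r₂) (half_pos hr₂) (half_lt_self hr₂)
  have h0fun : (fun _ : Fin 3 => (0 : ℝ)) = 0 := rfl
  rw [h0fun] at hχ1 hχsupp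
  set g : (Fin 3 → ℝ) × ℝ → ℂ := fun q => ((χ q.1 : ℝ) : ℂ) * (h₁ q.1 * (u q.1)⁻¹) with hgdef
  have hg : ContDiff ℝ ∞ g := by
    have hq : ContDiffOn ℝ ∞ (fun x : Fin 3 → ℝ => h₁ x * (u x)⁻¹) (ball (0 : Fin 3 → ℝ) r₂) :=
      hh₁.contDiffOn.mul (hu.contDiffOn.inv fun x hx => hune x (ball_subset_ball (min_le_right _ _) hx))
    have h1 : ContDiff ℝ ∞ fun x : Fin 3 → ℝ => ((χ x : ℝ) : ℂ) * (h₁ x * (u x)⁻¹) := contDiff_ofReal_mul_of_tsupport_subset isOpen_ball hχ hχsupp hq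
    exact h1.comp contDiff_fst
  have hgσ : ∀ (σ : Equiv.Perm (Fin 3)) (x : Fin 3 → ℝ) (z : ℝ), g (x ∘ ⇑σ, z) = g (x, z) := fun σ x z => by
    simp only [hgdef, hχσ σ x, hh₁σ σ x, huσ σ x]
  obtain ⟨W, hWo, hbW, F, hF, δ, hδ, hFg⟩ := exists_contDiffOn_comp_cornerClass_of_forall_perm (P := ℝ) (E := ℂ) θζ g hg hgσ
  -- the base point of ★ (E) is `b`
  have hexp : ∀ s : ℝ, Complex.exp ((((θζ + s : ℝ)) : ℂ) * I) = ((ζ * Circle.exp s : Circle) : ℂ) := fun s => by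
    rw [← Circle.coe_exp, Circle.exp_add, hζ]
  have hbase : ((Complex.exp ((((θζ + 0 : ℝ)) : ℂ) * I) + Complex.exp ((((θζ + 0 : ℝ)) : ℂ) * I) + Complex.exp ((((θζ + 0 : ℝ)) : ℂ) * I),
      Complex.exp ((((θζ + 0 : ℝ)) : ℂ) * I) * Complex.exp ((((θζ + 0 : ℝ)) : ℂ) * I) + Complex.exp ((((θζ + 0 : ℝ)) : ℂ) * I) * Complex.exp ((((θζ + 0 : ℝ)) : ℂ) * I) +
        Complex.exp ((((θζ + 0 : ℝ)) : ℂ) * I) * Complex.exp ((((θζ + 0 : ℝ)) : ℂ) * I),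
      Complex.exp ((((θζ + 0 : ℝ)) : ℂ) * I) * Complex.exp ((((θζ + 0 : ℝ)) : ℂ) * I) * Complex.exp ((((θζ + 0 : ℝ)) : ℂ) * I)) : ℂ × ℂ × ℂ) = b := by
    rw [hexp 0, Circle.exp_zero, mul_one, hbdef, esymm3_apply]
  rw [hbase] at hbW
  -- the outer cut-off on `ℂ³`
  obtain ⟨ρ, hρ, hρW⟩ := Metric.isOpen_iff.1 hWo b hbW
  set ε₂ : ℝ := ρ / 2 with hε₂def
  have hε₂ : 0 < ε₂ := half_pos hρ
  obtain ⟨χ₂, hχ₂, hχ₂1, hχ₂supp⟩ := exists_contDiff_eq_one_closedBall_tsupport_subset b hε₂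
  have hχ₂W : tsupport χ₂ ⊆ W := hχ₂supp.trans ((Metric.ball_subset_ball (by rw [hε₂def]; linarith)).trans hρW)
  set h : ℂ × ℂ × ℂ → ℂ := fun z => ((χ₂ z : ℝ) : ℂ) * F (z, 0) with hhdef
  have hF0 : ContDiffOn ℝ ∞ (fun z : ℂ × ℂ × ℂ => F (z, 0)) W :=
    hF.comp (contDiffOn_id.prodMk contDiffOn_const) fun z hz => ⟨hz, Set.mem_univ _⟩
  have hh : ContDiff ℝ ∞ h := contDiff_ofReal_mul_of_tsupport_subset hWo hχ₂ hχ₂W hF0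
  -- `h b = h₁ 0 ∕ u 0 ≠ 0`
  have hg0 : g (0, 0) = h₁ 0 * (u 0)⁻¹ := by
    simp only [hgdef, hχ1 0 (mem_ball_self (half_pos hr₂)), Complex.ofReal_one, one_mul]
  have hFb : F (b, 0) = h₁ 0 * (u 0)⁻¹ := by
    have h := (hFg 0 (by rw [norm_zero]; exact hδ) 0).2
    simp only [Pi.zero_apply] at h
    rw [hbase] at h
    rw [h, hg0]
  have hhb : h b ≠ 0 := by
    show ((χ₂ b : ℝ) : ℂ) * F (b, 0) ≠ 0
    rw [hχ₂1 b (mem_closedBall_self hε₂.le), Complex.ofReal_one, one_mul, hFb]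
    exact mul_ne_zero hh₁0 (inv_ne_zero hu0)
  -- ## §3 the radii: representative angles `x` must be small
  set r₃ : ℝ := min (r₂ / 2) (δ / 2) with hr₃def
  have hr₃ : 0 < r₃ := lt_min (half_pos hr₂) (half_pos hδ)
  obtain ⟨η, hη, hηarg⟩ := exists_forall_arg_div_small ζ hr₃
  obtain ⟨δc, hδc, hTc⟩ := exists_cornerClassTubeG_compact (W := {w : InfinitePlace L // IsComplex w}) hζn hη
  obtain ⟨δs, hδs, hTs⟩ := exists_cornerClassTubeG_split (W := {w : InfinitePlace L // IsComplex w}) hζn hεB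
  set ε : ℝ := min (min δc δs) ε₂ with hεdef
  have hε : 0 < ε := lt_min (lt_min hδc hδs) hε₂
  -- ## §4 the head
  refine (epGeneratorAt_iff b).2 ⟨ε, hε, f, ⟨fa, hfa, hf⟩, hfs, h, hh, hhb, ?_, ?_⟩
  · -- SPLIT clause: the class tube puts the boost eigenvalues `ε_B`-close to `ζ`, and (B) vanishes
    intro S' c hwS hc0 hdist
    have hd : dist (bzClassMapG S' c w) (esymm3 fun _ : Fin 3 => (ζ : ℂ)) < δs := hdist.trans_le ((min_le_left _ _).trans (min_le_right _ _))
    obtain ⟨-, h1, h0, h2⟩ := hTs S' c w hwS hd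
    refine hvanB S' hwS (c w) hc0 fun i => ?_
    fin_cases i
    · simpa [boostEig] using h0
    · simpa [boostEig] using h1
    · simpa [boostEig] using h2
  · -- COMPACT clause
    intro S' c hwS hinj hdist
    have hdc : dist (bzClassMapG S' c w) (esymm3 fun _ : Fin 3 => (ζ : ℂ)) < δc := hdist.trans_le ((min_le_left _ _).trans (min_le_left _ _))
    have hnear : ∀ k, ‖Complex.exp ((c w k : ℂ) * I) - (ζ : ℂ)‖ < η := hTc S' c w hwS hdc
    -- the representative `x`
    set x : Fin 3 → ℝ := fun k => Complex.arg (((Circle.exp (c w k) : Circle) : ℂ) / (ζ : ℂ)) with hxdef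
    have hxζ : ∀ k, Circle.exp (((fun _ : Fin 3 => θζ) + x) k) = Circle.exp (c w k) := fun k => circleExp_const_add_arg_eq hζ (c w) k
    have hxball : x ∈ ball (0 : Fin 3 → ℝ) r₃ :=
      hηarg (fun k => Circle.exp (c w k)) fun k => by rw [Circle.coe_exp]; exact hnear k
    have hx2 : x ∈ ball (0 : Fin 3 → ℝ) (r₂ / 2) := ball_subset_ball (min_le_left _ _) hxball
    have hx4 : x ∈ ball (0 : Fin 3 → ℝ) (r / 4) := ball_subset_ball ((half_le_self hr₂.le).trans (min_le_left _ _)) hx2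
    have hxδ : ‖x‖ < δ := by
      have := mem_ball_zero_iff.1 hxball
      exact this.trans_le ((min_le_right _ _).trans (half_le_self hδ.le))
    have hxinj : Function.Injective x := by
      intro i j hij
      apply hinj
      show Circle.exp (c w i) = Circle.exp (c w j)
      rw [← hxζ i, ← hxζ j, Pi.add_apply, Pi.add_apply, hij]
    -- the slot sum in the representative: label `∅`, periodicity, ★ F-C §3
    have hS0 : (∑ σ : Equiv.Perm (Fin 3), chartOrbGLoc L ![(2 : L)⁻¹, 1, -(2 : L)⁻¹] w S' (ν'w w) f (c w ∘ ⇑σ)) =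
        ∑ σ : Equiv.Perm (Fin 3), chartOrbGLoc L ![(2 : L)⁻¹, 1, -(2 : L)⁻¹] w (∅ : Finset {w : InfinitePlace L // IsComplex w}) (ν'w w) f
          ((((fun _ : Fin 3 => θζ) + x)) ∘ ⇑σ) := by
      rw [Finset.sum_congr rfl fun (σ : Equiv.Perm (Fin 3)) _ =>
        chartOrbGLoc_eq_of_mem_iff L ![(2 : L)⁻¹, 1, -(2 : L)⁻¹] w (ν'w w) (iff_of_false hwS hw0) f (c w ∘ ⇑σ)]
      exact sum_perm_chartOrbGLoc_congr_of_circleExp_eq L ![(2 : L)⁻¹, 1, -(2 : L)⁻¹] w ∅ (ν'w w) hw0 f fun k => (hxζ k).symm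
    have hS1 : (∑ σ : Equiv.Perm (Fin 3), chartOrbGLoc L ![(2 : L)⁻¹, 1, -(2 : L)⁻¹] w (∅ : Finset {w : InfinitePlace L // IsComplex w}) (ν'w w) f
          ((((fun _ : Fin 3 => θζ) + x)) ∘ ⇑σ)) =
        ∑ σ : Equiv.Perm (Fin 3), chartOrbGLoc L ![(2 : L)⁻¹, 1, -(2 : L)⁻¹] w (∅ : Finset {w : InfinitePlace L // IsComplex w}) (ν'w w) f
          ((fun _ : Fin 3 => θζ) + x ∘ ⇑σ) :=
      Finset.sum_congr rfl fun σ _ => rfl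
    have hslot := unit_mul_sum_perm_reading_eq
      (fun y => chartOrbGLoc L ![(2 : L)⁻¹, 1, -(2 : L)⁻¹] w (∅ : Finset {w : InfinitePlace L // IsComplex w}) (ν'w w) f ((fun _ : Fin 3 => θζ) + y))
      Ft H h₁ u hr hFtR hHFt hA hN hx4 hxinj
    have hux : u x ≠ 0 := hune x (ball_subset_ball ((half_le_self hr₂.le).trans (min_le_right _ _)) hx2)
    have hsum : (∑ σ : Equiv.Perm (Fin 3), chartOrbGLoc L ![(2 : L)⁻¹, 1, -(2 : L)⁻¹] w S' (ν'w w) f (c w ∘ ⇑σ)) = h₁ x * (u x)⁻¹ := by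
      rw [hS0, hS1, eq_mul_inv_iff_mul_eq₀ hux, mul_comm]
      exact hslot
    -- the class of `c w` is the ★ (E) class of `x`
    have hcls : bzClassMapG S' c w = esymm3 (fun k => Complex.exp ((((θζ + x k : ℝ)) : ℂ) * I)) := by
      rw [bzClassMapG_apply_of_not_mem L w c hwS]
      congr 1
      funext k
      rw [hexp, ← Circle.coe_exp, ← hxζ k, circleExp_const_add, hζ]
    have hEx := hFg x hxδ 0
    rw [show ((Complex.exp ((((θζ + x 0 : ℝ)) : ℂ) * I) + Complex.exp ((((θζ + x 1 : ℝ)) : ℂ) * I) + Complex.exp ((((θζ + x 2 : ℝ)) : ℂ) * I),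
        Complex.exp ((((θζ + x 0 : ℝ)) : ℂ) * I) * Complex.exp ((((θζ + x 1 : ℝ)) : ℂ) * I) +
            Complex.exp ((((θζ + x 0 : ℝ)) : ℂ) * I) * Complex.exp ((((θζ + x 2 : ℝ)) : ℂ) * I) +
          Complex.exp ((((θζ + x 1 : ℝ)) : ℂ) * I) * Complex.exp ((((θζ + x 2 : ℝ)) : ℂ) * I),
        Complex.exp ((((θζ + x 0 : ℝ)) : ℂ) * I) * Complex.exp ((((θζ + x 1 : ℝ)) : ℂ) * I) * Complex.exp ((((θζ + x 2 : ℝ)) : ℂ) * I)) : ℂ × ℂ × ℂ) =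
        esymm3 (fun k => Complex.exp ((((θζ + x k : ℝ)) : ℂ) * I)) from
      (esymm3_apply (fun k => Complex.exp ((((θζ + x k : ℝ)) : ℂ) * I))).symm, ← hcls] at hEx
    obtain ⟨hclsW, hFcls⟩ := hEx
    -- evaluate `h` at the class
    rw [hsum]
    show h₁ x * (u x)⁻¹ = ((χ₂ (bzClassMapG S' c w) : ℝ) : ℂ) * F (bzClassMapG S' c w, 0)
    rw [hχ₂1 _ (mem_closedBall.2 (hdist.le.trans (min_le_right _ _))), Complex.ofReal_one, one_mul, hFcls]
    simp only [hgdef, hχ1 x hx2, Complex.ofReal_one, one_mul]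

end Corner

/-! ## ED. 2 — THE CLOSER: the binders discharged by ★ (10)(B) `exists_centralType_generator` -/

section Periodicity

variable (L : Type) [Field L] [NumberField L] [IsCMField L] (w : {w : InfinitePlace L // IsComplex w})

/-- **2π-PERIODICITY OF THE LOCAL CHART IN AN ANGLE SLOT** (any frame `α`, any label; slot `i ≠ 0`, or any slot at a compact-chart place): `gprimeBlockAt (cw + 2πk·e_i) = gprimeBlockAt cw`
(★ `gprimeBlockAt_add`, ★ `gprimeTorus_angleShift_eq_one`). [cite: Rogawski1990, §3.6 p. 28] [cite: Shelstad1979, §4 p. 22] -/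
theorem gprimeBlockAt_add_single_two_pi_mul (α : Fin 3 → L) (S' : Finset {w : InfinitePlace L // IsComplex w}) {i : Fin 3} (h : w ∉ S' ∨ i ≠ 0) (k : ℤ)
    (cw : Fin 3 → ℝ) :
    gprimeBlockAt L α w S' (cw + Pi.single i (2 * Real.pi * k)) = gprimeBlockAt L α w S' cw := by
  rw [gprimeBlockAt_add]
  have h1 : gprimeBlockAt L α w S' (Pi.single i (2 * Real.pi * k)) = 1 := by
    have e : (Pi.single i (2 * Real.pi * k) : Fin 3 → ℝ) = angleShift w i k w := by
      simp only [angleShift, Pi.single_eq_same]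
    have h2 := archPiEquivCM_gprimeTorus L α S' (angleShift w i k) w
    rw [gprimeTorus_angleShift_eq_one L α S' h k, map_one, Pi.one_apply, gprimeBlock_eq_gprimeBlockAt] at h2
    rw [e, ← h2]
  rw [h1, mul_one]

/-- `|x| < ε` as soon as both `|e^{x} − 1| < ε` and `|e^{−x} − 1| < ε` (`1 + x ≤ e^{x}`). [cite: Rogawski1990, §8.4 p. 126] -/
theorem abs_lt_of_abs_exp_sub_one_lt {x ε : ℝ} (h1 : |Real.exp x - 1| < ε) (h2 : |Real.exp (-x) - 1| < ε) : |x| < ε := by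
  have a1 := Real.add_one_le_exp x
  have a2 := Real.add_one_le_exp (-x)
  rw [abs_lt] at h1 h2 ⊢
  constructor <;> linarith [h1.2, h2.2]

end Periodicity

section Closer

variable (L : Type) [Field L] [NumberField L] [IsCMField L]
  [∀ v : {w : InfinitePlace L // IsComplex w}, MeasurableSpace ↥(archLocal L 3 (Matrix.diagonal ![(2 : L)⁻¹, 1, -(2 : L)⁻¹]) v)]
  [∀ v : {w : InfinitePlace L // IsComplex w}, BorelSpace ↥(archLocal L 3 (Matrix.diagonal ![(2 : L)⁻¹, 1, -(2 : L)⁻¹]) v)]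
  [MeasurableSpace ↥(arch (↥(maximalRealSubfield L)) L (IsCMField.complexConj L) 3 (Matrix.diagonal ![(2 : L)⁻¹, 1, -(2 : L)⁻¹]))]
  [BorelSpace ↥(arch (↥(maximalRealSubfield L)) L (IsCMField.complexConj L) 3 (Matrix.diagonal ![(2 : L)⁻¹, 1, -(2 : L)⁻¹]))]
  (ν'w : ∀ v : {w : InfinitePlace L // IsComplex w}, Measure ↥(archLocal L 3 (Matrix.diagonal ![(2 : L)⁻¹, 1, -(2 : L)⁻¹]) v))
  [∀ v, (ν'w v).IsHaarMeasure] [∀ v, (ν'w v).IsMulRightInvariant]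
  (ν' : Measure ↥(arch (↥(maximalRealSubfield L)) L (IsCMField.complexConj L) 3 (Matrix.diagonal ![(2 : L)⁻¹, 1, -(2 : L)⁻¹]))) [ν'.IsHaarMeasure] [ν'.IsMulRightInvariant]
  (hν : ν' = (Measure.pi ν'w).map (archPiEquivCM 3 L (Matrix.diagonal ![(2 : L)⁻¹, 1, -(2 : L)⁻¹])).symm)
  (w : {w : InfinitePlace L // IsComplex w})

open scoped Matrix.Norms.Operator

omit [MeasurableSpace ↥(arch (↥(maximalRealSubfield L)) L (IsCMField.complexConj L) 3 (Matrix.diagonal ![(2 : L)⁻¹, 1, -(2 : L)⁻¹]))]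
  [BorelSpace ↥(arch (↥(maximalRealSubfield L)) L (IsCMField.complexConj L) 3 (Matrix.diagonal ![(2 : L)⁻¹, 1, -(2 : L)⁻¹]))] in
/-- **FROM THE NEIGHBOURHOOD FORM TO THE EIGENVALUE FORM OF THE VANISHING** (one corner lift suffices, by 2π-periodicity of the split chart in its two angle slots): if the split
reading vanishes on a neighbourhood `V` of the Cayley corner `(0, θ_ζ, θ_ζ)` (off `cw₀ = 0`), then it vanishes at every `cw` (`cw₀ ≠ 0`) whose boost eigenvalues are `ε_B`-close
to `ζ`. [cite: Rogawski1990, §3.6 p. 28; §8.4 p. 126] [cite: Shelstad1979, §4 p. 22] -/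
theorem splitReading_eq_zero_of_boostEig_near {ζ : Circle} {θζ : ℝ} (hζ : Circle.exp θζ = ζ) (S' : Finset {w : InfinitePlace L // IsComplex w})
    (f : ↥(archLocal L 3 (Matrix.diagonal ![(2 : L)⁻¹, 1, -(2 : L)⁻¹]) w) → ℂ) {V : Set (Fin 3 → ℝ)} (hV : V ∈ 𝓝 (![0, θζ, θζ] : Fin 3 → ℝ))
    (hvanV : ∀ cw ∈ V, cw 0 ≠ 0 → chartOrbGLoc L ![(2 : L)⁻¹, 1, -(2 : L)⁻¹] w S' (ν'w w) f cw = 0) :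
    ∃ εB : ℝ, 0 < εB ∧ ∀ cw : Fin 3 → ℝ, cw 0 ≠ 0 → (∀ i, ‖boostEig cw i - (ζ : ℂ)‖ < εB) →
      chartOrbGLoc L ![(2 : L)⁻¹, 1, -(2 : L)⁻¹] w S' (ν'w w) f cw = 0 := by
  obtain ⟨ρ, hρ, hball⟩ := Metric.mem_nhds_iff.1 hV
  obtain ⟨η, hη, hηarg⟩ := exists_forall_arg_div_small ζ hρ
  refine ⟨min (η / 2) (ρ / 2), lt_min (half_pos hη) (half_pos hρ), fun cw hcw0 hB => ?_⟩
  have hBη : ∀ i, ‖boostEig cw i - (ζ : ℂ)‖ < η / 2 := fun i => (hB i).trans_le (min_le_left _ _)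
  have hBρ : ∀ i, ‖boostEig cw i - (ζ : ℂ)‖ < ρ / 2 := fun i => (hB i).trans_le (min_le_right _ _)
  have hζn : ‖(ζ : ℂ)‖ = 1 := Circle.norm_coe ζ
  -- the three eigenvalues
  have hb0 : boostEig cw 0 = Complex.exp ((cw 0 : ℂ) + (cw 2 : ℂ) * I) := rfl
  have hb1 : boostEig cw 1 = Complex.exp ((cw 1 : ℂ) * I) := rfl
  have hb2 : boostEig cw 2 = Complex.exp (-(cw 0 : ℂ) + (cw 2 : ℂ) * I) := rfl
  have hn0 : ‖boostEig cw 0‖ = Real.exp (cw 0) := by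
    rw [hb0, Complex.norm_exp]; simp
  have hn2 : ‖boostEig cw 2‖ = Real.exp (-cw 0) := by
    rw [hb2, Complex.norm_exp]; simp
  -- `|cw 0| < ρ ∕ 2`
  have hx : |cw 0| < ρ / 2 := by
    refine abs_lt_of_abs_exp_sub_one_lt ?_ ?_
    · have := abs_norm_sub_norm_le (boostEig cw 0) (ζ : ℂ)
      rw [hn0, hζn] at this
      exact this.trans_lt (hBρ 0)
    · have := abs_norm_sub_norm_le (boostEig cw 2) (ζ : ℂ)
      rw [hn2, hζn] at this
      exact this.trans_lt (hBρ 2)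
  -- the phases `e^{i cw₁}`, `e^{i cw₂}` are `η`-close to `ζ`
  have hE : |Real.exp (cw 0) - 1| < η / 2 := by
    have := abs_norm_sub_norm_le (boostEig cw 0) (ζ : ℂ)
    rw [hn0, hζn] at this
    exact this.trans_lt (hBη 0)
  have hp1 : ‖((Circle.exp (cw 1) : Circle) : ℂ) - (ζ : ℂ)‖ < η := by
    rw [Circle.coe_exp, ← hb1]; exact (hBη 1).trans (half_lt_self hη)
  have hp2 : ‖((Circle.exp (cw 2) : Circle) : ℂ) - (ζ : ℂ)‖ < η := by
    have hdecomp : ((Circle.exp (cw 2) : Circle) : ℂ) - (ζ : ℂ) =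
        (1 - ((Real.exp (cw 0) : ℝ) : ℂ)) * Complex.exp ((cw 2 : ℂ) * I) + (boostEig cw 0 - (ζ : ℂ)) := by
      rw [Circle.coe_exp, hb0, Complex.exp_add, Complex.ofReal_exp]; ring
    rw [hdecomp]
    refine (norm_add_le _ _).trans_lt ?_
    rw [norm_mul, Complex.norm_exp_ofReal_mul_I, mul_one]
    have : ‖(1 : ℂ) - ((Real.exp (cw 0) : ℝ) : ℂ)‖ = |Real.exp (cw 0) - 1| := by
      rw [← Complex.ofReal_one, ← Complex.ofReal_sub, Complex.norm_real, Real.norm_eq_abs, abs_sub_comm]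
    rw [this]
    linarith [hBη 0]
  -- the angle representatives `a₀ = arg(e^{i cw₁}∕ζ)`, `a₁ = arg(e^{i cw₂}∕ζ)` are `ρ`-small
  set z : Fin 3 → Circle := ![Circle.exp (cw 1), Circle.exp (cw 2), Circle.exp (cw 2)] with hz
  have hzarg := hηarg z (fun k => by
    fin_cases k
    · simpa [hz] using hp1
    · simpa [hz] using hp2
    · simpa [hz] using hp2)
  set a : Fin 3 → ℝ := fun k => Complex.arg (((z k : Circle) : ℂ) / (ζ : ℂ)) with ha
  have haρ : ∀ k, |a k| < ρ := by
    have h := mem_ball_zero_iff.1 hzarg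
    rw [pi_norm_lt_iff hρ] at h
    intro k
    simpa only [Real.norm_eq_abs] using h k
  -- the representative coordinate `cw′ = (cw₀, θ_ζ + a₀, θ_ζ + a₁)` lies in `V`
  set cw' : Fin 3 → ℝ := ![cw 0, θζ + a 0, θζ + a 1] with hcw'
  have hcw'V : cw' ∈ V := by
    apply hball
    rw [mem_ball, dist_pi_lt_iff hρ]
    intro k
    fin_cases k
    · simpa [hcw', Real.dist_eq] using hx.trans (half_lt_self hρ)
    · simpa [hcw', Real.dist_eq] using haρ 0
    · simpa [hcw', Real.dist_eq] using haρ 1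
  -- the phases of `cw′` and `cw` agree, so the slots differ by multiples of `2π`
  have he1 : Circle.exp (θζ + a 0) = Circle.exp (cw 1) := by
    rw [Circle.exp_add, hζ]
    simpa [ha, hz] using mul_exp_arg_div_eq ζ (Circle.exp (cw 1))
  have he2 : Circle.exp (θζ + a 1) = Circle.exp (cw 2) := by
    rw [Circle.exp_add, hζ]
    simpa [ha, hz] using mul_exp_arg_div_eq ζ (Circle.exp (cw 2))
  obtain ⟨m₁, hm₁⟩ := Circle.exp_eq_exp.1 he1.symm
  obtain ⟨m₂, hm₂⟩ := Circle.exp_eq_exp.1 he2.symm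
  have hdec : cw = cw' + Pi.single 1 (2 * Real.pi * m₁) + Pi.single 2 (2 * Real.pi * m₂) := by
    funext k
    fin_cases k
    · show cw 0 = cw' 0 + (Pi.single (1 : Fin 3) (2 * Real.pi * (m₁ : ℝ)) : Fin 3 → ℝ) 0 + (Pi.single (2 : Fin 3) (2 * Real.pi * (m₂ : ℝ)) : Fin 3 → ℝ) 0
      rw [Pi.single_eq_of_ne (by decide), Pi.single_eq_of_ne (by decide), hcw']
      simp
    · show cw 1 = cw' 1 + (Pi.single (1 : Fin 3) (2 * Real.pi * (m₁ : ℝ)) : Fin 3 → ℝ) 1 + (Pi.single (2 : Fin 3) (2 * Real.pi * (m₂ : ℝ)) : Fin 3 → ℝ) 1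
      rw [Pi.single_eq_same, Pi.single_eq_of_ne (by decide), hcw']
      simp only [Matrix.cons_val_one, Matrix.cons_val_zero, add_zero]
      linear_combination hm₁
    · show cw 2 = cw' 2 + (Pi.single (1 : Fin 3) (2 * Real.pi * (m₁ : ℝ)) : Fin 3 → ℝ) 2 + (Pi.single (2 : Fin 3) (2 * Real.pi * (m₂ : ℝ)) : Fin 3 → ℝ) 2
      rw [Pi.single_eq_same, Pi.single_eq_of_ne (by decide), hcw']
      simp only [Matrix.cons_val_two, Matrix.tail_cons, Matrix.head_cons, add_zero]
      linear_combination hm₂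
  -- periodicity of the split chart in its angle slots `1`, `2`
  have hper : gprimeBlockAt L ![(2 : L)⁻¹, 1, -(2 : L)⁻¹] w S' cw = gprimeBlockAt L ![(2 : L)⁻¹, 1, -(2 : L)⁻¹] w S' cw' := by
    rw [hdec, gprimeBlockAt_add_single_two_pi_mul L w _ S' (Or.inr (by decide)) m₂,
      gprimeBlockAt_add_single_two_pi_mul L w _ S' (Or.inr (by decide)) m₁]
  rw [chartOrbGLoc_congr L ![(2 : L)⁻¹, 1, -(2 : L)⁻¹] w S' (ν'w w) f hper]
  exact hvanV cw' hcw'V (by simpa [hcw'] using hcw0)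

include hν in
/-- **THE SCALAR-CORNER ONE-PLACE EP GENERATOR, UNCONDITIONAL**: `EPGeneratorAt L β₀ w (ν′_w w) (esymm3 (ζ,ζ,ζ))` for every complex place `w` of a CM field and every `ζ ∈ S¹`
(`β₀ = (½,1,−½)`; product-measure block of ★ G3∕(J)).  The binders of ★ `epGeneratorAt_scalar_corner_of_centralGenerator` are discharged by ★ (10)(B)
`exists_centralType_generator` at the label `{w}` (every other split label reads the same, ★ `chartOrbGLoc_eq_of_mem_iff`): `fa(ζ•1) ≠ 0` because B's limit `ℓ ≠ 0` IS the letter's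
`−c′i·fa(diag(ζ,ζ,ζ))` (★ `ArchCentralLimitFormulaRankTwo_holds`, uniqueness of limits), and the eigenvalue form of the vanishing follows from B's neighbourhood form at the lift
`(0, θ_ζ, θ_ζ)` by periodicity (`splitReading_eq_zero_of_boostEig_near`). [cite: Rogawski1990, §8.2 p. 122; §8.4 pp. 126–127; §14.2 (14.2.1) p. 232]
[cite: Shelstad1979, §4 Lemma 4.2 p. 23, Lemma 4.3 p. 25] [cite: Bouaziz1994IntegralesOrbitales, §6.2 p. 591] [cite: HarishChandra1975HARRG1, §17 Lemma 17.5] -/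
theorem epGeneratorAt_scalar_corner (ζ : Circle) :
    EPGeneratorAt L ![(2 : L)⁻¹, 1, -(2 : L)⁻¹] w (ν'w w) (esymm3 fun _ : Fin 3 => (ζ : ℂ)) := by
  haveI := locallyCompactSpace_archLocal_three L ![(2 : L)⁻¹, 1, -(2 : L)⁻¹] w
  haveI := secondCountableTopology_archLocal_three L ![(2 : L)⁻¹, 1, -(2 : L)⁻¹] w
  obtain ⟨fa, ℓ, hfa, -, -, hsupp, hℓ, hvanV, hlim⟩ := exists_centralType_generator L w (ν'w w) ({w} : Finset {w : InfinitePlace L // IsComplex w})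
    (Finset.mem_singleton_self w) ζ Filter.univ_mem
  have hζ : Circle.exp (Complex.arg (ζ : ℂ)) = ζ := Circle.exp_arg ζ
  obtain ⟨V, hV, hvan0⟩ := hvanV _ _ hζ hζ
  obtain ⟨εB, hεB, hvanB⟩ := splitReading_eq_zero_of_boostEig_near L ν'w w hζ {w}
    (fun g => fa ((g : GL (Fin 3) ℂ) : Matrix (Fin 3) (Fin 3) ℂ)) hV hvan0
  -- `fa(ζ•1) ≠ 0` from `ℓ ≠ 0` and the letter
  have hα := quasiSplitWeights_ne_zero L
  have hreal := im_embedding_quasiSplitWeights_eq_zero L w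
  have hind : ∃ i j : Fin 3, (w.1.embedding ((![(2 : L)⁻¹, 1, -(2 : L)⁻¹]) i)).re * (w.1.embedding ((![(2 : L)⁻¹, 1, -(2 : L)⁻¹]) j)).re < 0 :=
    ⟨0, 2, re_embedding_quasiSplitWeights_zero_mul_two_neg L w⟩
  obtain ⟨c, hc, hletter⟩ := ArchCentralLimitFormulaRankTwo_holds L ![(2 : L)⁻¹, 1, -(2 : L)⁻¹] w hα hreal hind (ν'w w)
  have T1 := hletter fa hfa hsupp ζ
  haveI := nhdsWithin_injective_const_neBot ζ
  have hℓeq := tendsto_nhds_unique T1 hlim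
  have hdiag : ((circleDiagonal 3 (fun _ : Fin 3 => ζ) : GL (Fin 3) ℂ) : Matrix (Fin 3) (Fin 3) ℂ) = (ζ : ℂ) • (1 : Matrix (Fin 3) (Fin 3) ℂ) := by
    rw [coe_circleDiagonal, Matrix.smul_one_eq_diagonal]
  have hval : fa ((ζ : ℂ) • (1 : Matrix (Fin 3) (Fin 3) ℂ)) ≠ 0 := by
    intro h0
    apply hℓ
    rw [← hℓeq, hdiag, h0, mul_zero]
  refine epGeneratorAt_scalar_corner_of_centralGenerator L ν'w ν' hν w ζ fa hfa hsupp hval ⟨εB, hεB, fun S' hwS cw h0 hB => ?_⟩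
  rw [chartOrbGLoc_eq_of_mem_iff L ![(2 : L)⁻¹, 1, -(2 : L)⁻¹] w (ν'w w) (iff_of_true hwS (Finset.mem_singleton_self w)) _ cw]
  exact hvanB cw h0 hB

end Closer


end Literature.NumberTheory.Rogawski1990

end
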